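import Summits.HodgeConjecture.HodgeConjecture.Theorems.Ring2ClassTargets
import Summits.HodgeConjecture.HodgeConjecture.Theorems.Ring2MotivProductCells
import Summits.HodgeConjecture.HodgeConjecture.Theorems.Ring2MotivProductCellsDiscOne
import Literature.AlgebraicGeometry.Motives.AbelianVarietyProductDimProofs
import Literature.AlgebraicGeometry.Motives.AbelianVarietyIsogenyProofs
import HarnessLib

/-!
# Ring 2 / MOTIV Part VII — the product cells in the `HCOnClass` frame of `Ring2ClassTargets`

HONEST FRAMING (cell `pub-hodge-ring2`, seat motiv gen 6): research route conditional on HC_CM; not a corollary;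
Q11.4-sentence-2 already refuted in dim ≥ 3. `HC_CM` below is ALWAYS the binder
`Summit.HodgeConjecture.HodgeConjecture.Theses.RankFourFaces.CMAbelianHodge` (item stmt-HodgeConjecture-3052) taken as an
ARGUMENT, never asserted; `HC_AV` is `Theses.PadicSemiregularLift.HodgeAbelianVarieties` (item stmt-HodgeConjecture-1333).
Nothing in this file is a new fact: every theorem is glue between the landed Part V
(`Theorems.Ring2MotivProductCells`: the cells `ProdCMCell 𝒜 𝒞` = "isogenous to `A × C`, `A ∈ 𝒜`, `C` of CM type in `𝒞`",
the splitting hypothesis shape `CellProductSpan 𝒜`, exactness `forall_prodCMCell_top_iff`), Part VI's summit twin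
(`Theorems.Ring2MotivProductCellsDiscOne`: the CM side `DiscOneWeilPowerClass` discharged by the refereed Floccari–Fu binder) and
the cell's class-target frame (`Theorems.Ring2ClassTargets`: `HCOnClass 𝒞 := ∀ A, 𝒞 A → HodgeConjectureFor A.dim A.X`,
`HCUpToDim g`, covers, the CM column `hcOnClass_cmType_iff_cmAbelianHodge`).

WHY (the LEAD's request, RING2-MAP §LEAD gen 4 L4.3/L4.7 and §motiv gen 5 "frame links skipped: `Ring2ClassTargets` olean
unbuilt"): the LEAD assembles `HCUpToDim 7` from typed cells with `ClassTargets.hcOnClass_of_cover`; the motiv cells must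
therefore be available as `HCOnClass (ProdCMCell 𝒜 𝒞)` statements with their EXACT worth:

* §1 dictionary: `HCOnClass (ProdCMCell 𝒜 𝒞)` is Part V's `∀ X, ProdCMCell 𝒜 𝒞 X → HodgeConjectureFor X.dim X.X`.
* §2 exactness in the frame: on a split class with a member on each side,
  `HCOnClass (ProdCMCell 𝒜 𝒞) ↔ HCOnClass 𝒜 ∧ HCOnClass (CM ∩ 𝒞)`; with `𝒞 = ⊤`:
  `↔ HCOnClass 𝒜 ∧ HC_CM` (KIND of HC_CM = LOAD-BEARING EXACTLY); with `𝒞 = (dim ≤ 3)` or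
  `𝒞 = DiscOneWeilPowerClass`: `↔ HCOnClass 𝒜` (KIND = ABSENT EXACTLY); Gordon / Lombardo instances.
* §3 under the cell's standing hypothesis `HC_CM`, every split product cell is worth exactly its non-CM class:
  `HCOnClass (ProdCMCell 𝒜 𝒞) ↔ HCOnClass 𝒜`.
* §4 the dimension axis: a product cell with `dim A ≤ a`, `dim C ≤ c` lies on the row `HCUpToDim (a + c)`
  (`dim (A × C) = dim A + dim C`, isogeny preserves dimension — both tree theorems), so `HCUpToDim (a + c)` closes it and,
  conversely, the cell hands `HCOnClass (𝒜 ∩ dim ≤ a)` back DOWN the axis with no hypothesis at all.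
* §5 on-path (mandatory): `HC_AV →` and `HodgeConjecture →` every cell.

What this file does NOT say (recorded in the seat's `MOTIV-G6-GENERATION-CENSUS.md`, HOME `RING2-MAP.md` §motiv gen 6): the
BONDED cells of the block-II census (`E_k^a × Y(k;(p,q)) × C′`, where `CellProductSpan` FAILS) are not instances of §2 — their
Hodge rings were censused by the seat's engines M/M2 (all exceptional classes are Weil classes of 4- or 6-dimensional Weil-type
sub-quotients, except the four `Hom` classes of the "K3-partner" sixfolds), and their HC status is "modulo Markman 2025
Thm 1.5.1 (UNREFEREED)", which is the tree's NAMED FACT `Markman2025_weilClasses_algebraic_hyperbolicSixfold` — a binder,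
not used here.

## References
* [MoonenZarhin1999LowDim] B. Moonen, Yu. Zarhin, Hodge classes on abelian varieties of low dimension, Math. Ann. 315
  (1999) 711–733, §3 (3.1), (1.8).
* [Milne1999] J. S. Milne, Lefschetz motives and the Tate conjecture, Compositio Math. 117 (1999) 45–76, §7 (H).
* [Gordon1999HodgeAVSurvey] B. B. Gordon, A survey of the Hodge conjecture for abelian varieties, App. B in J. Lewis,
  A survey of the Hodge conjecture (1999), §3.
* [Lombardo2016] D. Lombardo, On the ℓ-adic Galois representations attached to nonsimple abelian varieties,
  Ann. Inst. Fourier 66 (2016) 1217–1245, Lemma 3.4.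
* [FloccariFu2026] S. Floccari, L. Fu, The Hodge conjecture for Weil fourfolds with discriminant 1 via singular
  OG6-varieties, J. Math. Pures Appl. (2026), Theorem 1.2.
* [Fulton1998] W. Fulton, Intersection Theory, 2nd ed., §10.1 Example 10.1.2.
* [MumfordAV1970] D. Mumford, Abelian Varieties, §7 Application 3, §19.
* [Deligne2000] P. Deligne, The Hodge conjecture (Clay problem description), §1.
-/

set_option linter.dupNamespace false

noncomputable section

open CategoryTheory
open Literature.AlgebraicGeometry Literature.AlgebraicGeometry.Motives
open Literature.AlgebraicGeometry.HodgeTheory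
open Literature.AlgebraicGeometry.Milne1999
open Summit.HodgeConjecture.HodgeConjecture.Theses
open Summit.HodgeConjecture.HodgeConjecture.Ring2.ClassTargets

namespace Summit.HodgeConjecture.HodgeConjecture.Ring2.Motiv

variable {𝒜 𝒜' 𝒞 𝒞' : AbelianVariety ℂ → Prop}

/-! ## §1 Dictionary -/

/-- `HCOnClass` of a product cell is Part V's pointwise statement (definitional). [folklore] -/
theorem hcOnClass_prodCMCell_iff :
    HCOnClass (ProdCMCell 𝒜 𝒞) ↔ ∀ X : AbelianVariety ℂ, ProdCMCell 𝒜 𝒞 X → HodgeConjectureFor X.dim X.X :=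
  Iff.rfl

/-- The CM side of a cell as a class target: `HCOnClass (CM ∩ 𝒞)`. [folklore] -/
theorem hcOnClass_cm_inter_iff :
    HCOnClass (fun C ↦ IsOfCMType C ∧ 𝒞 C) ↔
      ∀ C : AbelianVariety ℂ, IsOfCMType C → 𝒞 C → HodgeConjectureFor C.dim C.X :=
  ⟨fun h C hCt hC ↦ h C ⟨hCt, hC⟩, fun h C hC ↦ h C hC.1 hC.2⟩

/-- Monotonicity of the cell target in both parameters. [folklore] -/
theorem hcOnClass_prodCMCell_mono (h𝒜 : ∀ A, 𝒜 A → 𝒜' A) (h𝒞 : ∀ C, 𝒞 C → 𝒞' C)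
    (h : HCOnClass (ProdCMCell 𝒜' 𝒞')) : HCOnClass (ProdCMCell 𝒜 𝒞) :=
  hcOnClass_mono (fun _ hX ↦ prodCMCell_mono h𝒜 h𝒞 hX) h

/-- Product cells are isogeny-closed, so passing to the isogeny closure changes nothing.
[cite: vanGeemen1994HodgeAV, §3.7 Lemma 3.7] -/
theorem isogenyClosure_prodCMCell_iff (X : AbelianVariety ℂ) :
    IsogenyClosure (ProdCMCell 𝒜 𝒞) X ↔ ProdCMCell 𝒜 𝒞 X :=
  ⟨fun ⟨_, hY, hXY⟩ ↦ prodCMCell_of_isIsogenous hXY hY, isogenyClosure_of_mem⟩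

/-! ## §2 Exactness in the frame -/

/-- **EXACTNESS of a split product cell** (a member on each side):
`HC(𝒜 × (CM ∩ 𝒞)) ↔ HC(𝒜) ∧ HC(CM ∩ 𝒞)`. [cite: MoonenZarhin1999LowDim, §3 (3.1)] [cite: Fulton1998, §10.1 Example 10.1.2] -/
theorem hcOnClass_prodCMCell_iff_and (hS : CellProductSpan 𝒜) (hA₀ : ∃ A : AbelianVariety ℂ, 𝒜 A)
    (hC₀ : ∃ C : AbelianVariety ℂ, IsOfCMType C ∧ 𝒞 C) :
    HCOnClass (ProdCMCell 𝒜 𝒞) ↔ HCOnClass 𝒜 ∧ HCOnClass (fun C ↦ IsOfCMType C ∧ 𝒞 C) :=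
  (forall_prodCMCell_iff hS hA₀ hC₀).trans (and_congr Iff.rfl hcOnClass_cm_inter_iff.symm)

/-- **EXACTNESS against `HC_CM`** (`𝒞 = ⊤`): `HC(𝒜 × CM) ↔ HC(𝒜) ∧ HC_CM` — on the full product cell over a non-empty
split class, `HC_CM` (the binder, by name) is LOAD-BEARING EXACTLY. [cite: Milne1999, §7 (H)] [cite: MoonenZarhin1999LowDim, §3 (3.1)] -/
theorem hcOnClass_prodCMCell_top_iff (hS : CellProductSpan 𝒜) (hA₀ : ∃ A : AbelianVariety ℂ, 𝒜 A)
    (hC₀ : ∃ C : AbelianVariety ℂ, IsOfCMType C) :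
    HCOnClass (ProdCMCell 𝒜 fun _ ↦ True) ↔ HCOnClass 𝒜 ∧ RankFourFaces.CMAbelianHodge :=
  forall_prodCMCell_top_iff hS hA₀ hC₀

/-- The same with the CM column written as a class target (`HCOnClass IsOfCMType ↔ HC_CM`).
[cite: Milne1999, §7 (H)] -/
theorem hcOnClass_prodCMCell_top_iff' (hS : CellProductSpan 𝒜) (hA₀ : ∃ A : AbelianVariety ℂ, 𝒜 A)
    (hC₀ : ∃ C : AbelianVariety ℂ, IsOfCMType C) :
    HCOnClass (ProdCMCell 𝒜 fun _ ↦ True) ↔ HCOnClass 𝒜 ∧ HCOnClass IsOfCMType := by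
  rw [hcOnClass_cmType_iff_cmAbelianHodge]
  exact hcOnClass_prodCMCell_top_iff hS hA₀ hC₀

/-- **EXACTNESS, CM side of dimension `≤ 3`**: `HC(𝒜 × CM_{≤3}) ↔ HC(𝒜)` — KIND of `HC_CM` = ABSENT EXACTLY.
[cite: MoonenZarhin1999LowDim, §3 (3.1)] -/
theorem hcOnClass_prodCMCell_cm_dim_le_three_iff (hS : CellProductSpan 𝒜)
    (hC₀ : ∃ C : AbelianVariety ℂ, IsOfCMType C ∧ C.dim ≤ 3) :
    HCOnClass (ProdCMCell 𝒜 fun C ↦ C.dim ≤ 3) ↔ HCOnClass 𝒜 :=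
  forall_prodCMCell_cm_dim_le_three_iff hS hC₀

/-- **EXACTNESS, CM side = isogenous to a power of a discriminant-1 Weil fourfold** (Part VI, Floccari–Fu binder `h5`):
`HC(𝒜 × (CM ∩ DiscOneWeilPower)) ↔ HC(𝒜)` — KIND = ABSENT EXACTLY. [cite: FloccariFu2026, Theorem 1.2] -/
theorem hcOnClass_prodCMCell_discOneWeilPower_iff (hS : CellProductSpan 𝒜)
    (h5 : FloccariFu2026_hodgeClasses_algebraic_powers_discOneWeilFourfold)
    (hC₀ : ∃ C : AbelianVariety ℂ, IsOfCMType C ∧ DiscOneWeilPowerClass C) :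
    HCOnClass (ProdCMCell 𝒜 DiscOneWeilPowerClass) ↔ HCOnClass 𝒜 :=
  forall_prodCMCell_discOneWeilPower_iff hS h5 hC₀

/-- Gordon instance of the exactness against `HC_CM` (`𝒜 ⊆ {Hg semisimple}`, binder `hG`).
[cite: Gordon1999HodgeAVSurvey, App. B §3] [cite: Milne1999, §7 (H)] -/
theorem hcOnClass_prodCMCell_semisimple_top_iff_of_gordon
    (hG : Gordon1999_hodgeClassesProductSpan_of_semisimple)
    (hA₀ : ∃ A : AbelianVariety ℂ, 𝒜 A ∧ HasSemisimpleHodgeGroup A)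
    (hC₀ : ∃ C : AbelianVariety ℂ, IsOfCMType C) :
    HCOnClass (ProdCMCell (fun A ↦ 𝒜 A ∧ HasSemisimpleHodgeGroup A) fun _ ↦ True) ↔
      HCOnClass (fun A ↦ 𝒜 A ∧ HasSemisimpleHodgeGroup A) ∧ RankFourFaces.CMAbelianHodge :=
  forall_prodCMCell_semisimple_top_iff_of_gordon hG hA₀ hC₀

/-- Lombardo instance of the exactness against `HC_CM` (`𝒜 ⊆ {no simple factor of type IV}`, binder `hL`).
[cite: Lombardo2016, Lemma 3.4] [cite: Milne1999, §7 (H)] -/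
theorem hcOnClass_prodCMCell_noTypeIV_top_iff_of_lombardo
    (hL : Lombardo2016_hodgeClassesProductSpan)
    (hA₀ : ∃ A : AbelianVariety ℂ, 𝒜 A ∧ HasNoTypeIVFactor A)
    (hC₀ : ∃ C : AbelianVariety ℂ, IsOfCMType C) :
    HCOnClass (ProdCMCell (fun A ↦ 𝒜 A ∧ HasNoTypeIVFactor A) fun _ ↦ True) ↔
      HCOnClass (fun A ↦ 𝒜 A ∧ HasNoTypeIVFactor A) ∧ RankFourFaces.CMAbelianHodge :=
  forall_prodCMCell_noTypeIV_top_iff_of_lombardo hL hA₀ hC₀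

/-- **Descent to the non-CM class needs nothing**: any product cell with one CM member hands back `HCOnClass 𝒜`
(no splitting hypothesis, no `HC_CM`). [cite: Fulton1998, §10.1 Example 10.1.2] -/
theorem hcOnClass_left_of_hcOnClass_prodCMCell (hC₀ : ∃ C : AbelianVariety ℂ, IsOfCMType C ∧ 𝒞 C)
    (h : HCOnClass (ProdCMCell 𝒜 𝒞)) : HCOnClass 𝒜 :=
  fun A hA ↦ hodgeConjectureFor_left_of_prodCMCell hC₀ h A hA

/-- **Descent to the CM class needs nothing** either. [cite: Fulton1998, §10.1 Example 10.1.2] -/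
theorem hcOnClass_cm_inter_of_hcOnClass_prodCMCell (hA₀ : ∃ A : AbelianVariety ℂ, 𝒜 A)
    (h : HCOnClass (ProdCMCell 𝒜 𝒞)) : HCOnClass (fun C ↦ IsOfCMType C ∧ 𝒞 C) :=
  fun C hC ↦ hodgeConjectureFor_right_of_prodCMCell hA₀ h C hC.1 hC.2

/-! ## §3 Under the cell's standing hypothesis `HC_CM` -/

/-- **Under `HC_CM` a split product cell is worth exactly its non-CM class**: `HCOnClass (ProdCMCell 𝒜 𝒞) ↔ HCOnClass 𝒜`
(for any CM-side class `𝒞` with a member). [cite: Milne1999, §7 (H)] [cite: MoonenZarhin1999LowDim, §3 (3.1)] -/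
theorem hcOnClass_prodCMCell_iff_left_of_hcCM (hCM : RankFourFaces.CMAbelianHodge) (hS : CellProductSpan 𝒜)
    (hC₀ : ∃ C : AbelianVariety ℂ, IsOfCMType C ∧ 𝒞 C) :
    HCOnClass (ProdCMCell 𝒜 𝒞) ↔ HCOnClass 𝒜 :=
  ⟨hcOnClass_left_of_hcOnClass_prodCMCell hC₀,
    fun h _ hX ↦ hodgeConjectureFor_of_prodCMCell_of_cmAbelianHodge hCM hS h
      (prodCMCell_mono (fun _ hA ↦ hA) (fun _ _ ↦ trivial) hX)⟩

/-- Under `HC_CM`, closing the non-CM class closes every product cell over it (split class).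
[cite: Milne1999, §7 (H)] [cite: MoonenZarhin1999LowDim, §3 (3.1)] -/
theorem hcOnClass_prodCMCell_of_hcCM_of_left (hCM : RankFourFaces.CMAbelianHodge) (hS : CellProductSpan 𝒜)
    (h : HCOnClass 𝒜) : HCOnClass (ProdCMCell 𝒜 𝒞) :=
  fun _ hX ↦ hodgeConjectureFor_of_prodCMCell_of_cmAbelianHodge hCM hS h
    (prodCMCell_mono (fun _ hA ↦ hA) (fun _ _ ↦ trivial) hX)

/-! ## §4 The dimension axis -/

/-- A member of the product cell with `dim A ≤ a` and `dim C ≤ c` has dimension `≤ a + c`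
(`dim (A × C) = dim A + dim C`; isogenous abelian varieties have equal dimension).
[cite: MumfordAV1970, §7 Application 3 (p. 63)] [cite: GortzWedhorn2020, Lemma 6.26] -/
theorem dim_le_of_prodCMCell_dim_le {a c : ℕ} {X : AbelianVariety ℂ}
    (hX : ProdCMCell (fun A ↦ 𝒜 A ∧ A.dim ≤ a) (fun C ↦ 𝒞 C ∧ C.dim ≤ c) X) : X.dim ≤ a + c := by
  obtain ⟨A, C, hXi, ⟨_, hA⟩, _, ⟨_, hC⟩⟩ := hX
  have hdim : X.dim = (A.prod C).dim := AbelianVariety.dim_eq_of_isIsogenous_holds hXi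
  rw [hdim, AbelianVariety.dim_prod]
  omega

/-- **The row closes the cell**: `HCUpToDim (a + c)` gives HC on every product cell with `dim A ≤ a`, `dim C ≤ c`
(no splitting, no `HC_CM`). [cite: Deligne2000, §1] -/
theorem hcOnClass_prodCMCell_of_hcUpToDim {a c : ℕ} (h : HCUpToDim (a + c)) :
    HCOnClass (ProdCMCell (fun A ↦ 𝒜 A ∧ A.dim ≤ a) (fun C ↦ 𝒞 C ∧ C.dim ≤ c)) :=
  hcOnClass_mono (fun _ hX ↦ dim_le_of_prodCMCell_dim_le hX) h

/-- **The cell hands HC back DOWN the axis**: HC on the product cell `(𝒜 ∩ dim ≤ a) × (CM ∩ 𝒞 ∩ dim ≤ c)` gives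
`HCOnClass (𝒜 ∩ dim ≤ a)`, given one CM member of `𝒞` of dimension `≤ c` (no hypothesis at all).
[cite: Fulton1998, §10.1 Example 10.1.2] -/
theorem hcOnClass_dim_le_of_hcOnClass_prodCMCell {a c : ℕ}
    (hC₀ : ∃ C : AbelianVariety ℂ, IsOfCMType C ∧ 𝒞 C ∧ C.dim ≤ c)
    (h : HCOnClass (ProdCMCell (fun A ↦ 𝒜 A ∧ A.dim ≤ a) (fun C ↦ 𝒞 C ∧ C.dim ≤ c))) :
    HCOnClass (fun A ↦ 𝒜 A ∧ A.dim ≤ a) := by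
  obtain ⟨C, hCt, hC, hCd⟩ := hC₀
  exact hcOnClass_left_of_hcOnClass_prodCMCell ⟨C, hCt, hC, hCd⟩ h

/-- **Row-to-row transfer through a split cell**: if `𝒜 ∩ dim ≤ a` splits off CM factors (`CellProductSpan`), then
under `HC_CM` the row `HCUpToDim a` already closes the cells `(𝒜 ∩ dim ≤ a) × (CM ∩ 𝒞)` in EVERY dimension — the
mechanism by which split cells never add content up the axis. [cite: MoonenZarhin1999LowDim, §3 (3.1)] [cite: Milne1999, §7 (H)] -/
theorem hcOnClass_prodCMCell_dim_le_of_hcCM_of_hcUpToDim {a : ℕ} (hCM : RankFourFaces.CMAbelianHodge)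
    (hS : CellProductSpan fun A ↦ 𝒜 A ∧ A.dim ≤ a) (h : HCUpToDim a) :
    HCOnClass (ProdCMCell (fun A ↦ 𝒜 A ∧ A.dim ≤ a) 𝒞) :=
  hcOnClass_prodCMCell_of_hcCM_of_left hCM hS (hcOnClass_mono (fun _ hA ↦ hA.2) h)

/-! ## §5 On path (mandatory) -/

/-- **ON-PATH: `HC_AV → HC(cell)`** (item stmt-HodgeConjecture-1333 by name). [cite: Deligne2000, §1] -/
theorem hcOnClass_prodCMCell_of_hodgeAbelianVarieties (h : PadicSemiregularLift.HodgeAbelianVarieties) :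
    HCOnClass (ProdCMCell 𝒜 𝒞) :=
  hcOnClass_of_hodgeAbelianVarieties _ h

/-- **ON-PATH: `HodgeConjecture → HC(cell)`**. [cite: Deligne2000, §1] -/
theorem hcOnClass_prodCMCell_of_hodgeConjecture (h : _root_.HodgeConjecture) : HCOnClass (ProdCMCell 𝒜 𝒞) :=
  hcOnClass_of_hodgeConjecture _ h

/-- Audit: under `HodgeConjecture` both sides of every exactness statement of §2 hold. [cite: Deligne2000, §1] -/
theorem hcOnClass_prodCMCell_and_sides_of_hodgeConjecture (h : _root_.HodgeConjecture) :
    HCOnClass (ProdCMCell 𝒜 𝒞) ∧ HCOnClass 𝒜 ∧ HCOnClass (fun C ↦ IsOfCMType C ∧ 𝒞 C) ∧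
      RankFourFaces.CMAbelianHodge :=
  ⟨hcOnClass_of_hodgeConjecture _ h, hcOnClass_of_hodgeConjecture _ h, hcOnClass_of_hodgeConjecture _ h,
    (prodCMCell_rows_of_hodgeConjecture h 𝒜 𝒞).2.2⟩

end Summit.HodgeConjecture.HodgeConjecture.Ring2.Motiv

end
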